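import Summits.AtomisticToContinuum.BoseEinsteinCondensation.Theorems.BECThomsonPrincipleFibreConductanceInfraredNecessity
import Summits.AtomisticToContinuum.BoseEinsteinCondensation.Theorems.BECThomsonPrincipleFibreConductanceStubParsevalShellIdentity
import HarnessLib

/-!
# Route `BECThomsonPrinciple`, crux `FibreConductance` (stmt-AtomisticToContinuum-9480):
# the crux's infrared content in occupation numbers — OCCUPATION CONTINUITY next to the source mode

The registered anchor `infraredNecessity` (p90785) states the thermodynamic-limit content that the crux
`FibreConductance` forces in fibre-Fourier form (`∫_{cellN} W |ĉ_P(e_nψ − βψ²)|² ≤ 4π²C|P|²/‖n‖²`).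
This file rewrites it in the vocabulary of the route's other cruxes (`cellOccupation` of
`planeWaveMode`, as in `GDTransfer`'s window law): for every exact zero-free datum of the window and
every lattice vector `P`,

  `n_{P−n}(|Φ|) ≤ 2·n_{−n}(|Φ|) + 8π² C |P|₂² N/‖n‖²`   (`occupationContinuity_of_fibreConductance`),

i.e. the occupation of every mode lattice-adjacent (`|P| = 1`) to the source mode `−n` exceeds twice
the occupation of `−n` by at most `8π²C N/‖n‖²` — `O(L)` particles at the top of the window
`‖n‖ ≍ M√ρ L/2π`. Single-mode control of the exact ground state at `O(N^{1/3})` per mode in the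
thermodynamic limit is Gaussian-domination strength (the mechanism of crux `GDTransfer`,
stmt-9482, turns `GaussianDominationCan`, stmt-9479, into exactly such a window law); kinetic or
Lee–Huang–Yang sum rules bound a single mode only by `O(N)`. Ingredients: `ĉ_{P−n}(ψ) = ĉ_P(e_nψ)`
(index shift), `= ĉ_P(e_nψ − βψ²) + β ĉ_P(ψ²)`, `|β ĉ_P(ψ²)| ≤ |β|/L³ = |ĉ_{−n}(ψ)|`
(`∫_cell ψ² = 1`), `|x + y|² ≤ 2|x|² + 2|y|²` (inline), and the fibre Fubini identity
`∫_{cellN} W|ĉ_q(ψ)|² = n_q(|Φ|)/N`.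

References: LSSY2005 §1.2 (1.17)–(1.18) (occupations); T. Kennedy, E. H. Lieb, B. S. Shastry,
J. Stat. Phys. 53 (1988) 1019 (shape of Gaussian-domination occupation bounds); crux workfiles
`Cruxes/FibreConductance/NOTES.md`.
-/

noncomputable section

namespace Summit.AtomisticToContinuum.BoseEinsteinCondensation.Cruxes.FibreConductance.CondensateFloor

open MeasureTheory
open scoped ENNReal ComplexConjugate
open Literature.MathematicalPhysics.QuantumManyBody.BoseGas
open Summit.AtomisticToContinuum.BoseEinsteinCondensation.Theses.BECThomsonPrinciple (FibreConductance)
open Summit.AtomisticToContinuum.BoseEinsteinCondensation.Theorems.GaussianDominationCan.Negative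
  (nsq nsq_nonneg)
open Summit.AtomisticToContinuum.BoseEinsteinCondensation.Cruxes.FibreConductance.ParsevalShellBootstrap
  (fibreW fibrePsi fibreBeta phase LowDensityWindow fibreW_nonneg fibrePsi_nonneg continuous_fibrePsi
    integral_fibrePsi_sq fibreBeta_eq_cellFourierCoeff phase_eq_cellWave contDiff_phase measurable_fibreW
    lintegral_fibreW_mul_norm_sq_cellFourierCoeff continuous_cellFourierCoeff_fibrePsi
    cellFourierCoeff_const_mul infraredNecessity ps_cellFourierCoeff_cellWave_mul ps_cellFourierCoeff_add)

variable {m : ℕ} {L : ℝ}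

/-- The Fourier modes of the conditional DENSITY are bounded by the zero mode:
`|ĉ_P(ψ(·|X̂)²)| ≤ L⁻³` (`∫_cell ψ² = 1`, `|e_P| = 1`). [folklore] -/
theorem norm_cellFourierCoeff_fibrePsi_sq_le (hL : 0 < L) (Φ : PeriodicTrialState (m + 1) L)
    (hΦ : ∀ X, Φ.ψ X ≠ 0) (X : Config (m + 1)) (P : Fin 3 → ℤ) :
    ‖cellFourierCoeff L (fun y => (fibrePsi Φ (Function.update X 0 y) : ℂ) ^ 2) P‖ ≤ (L ^ 3)⁻¹ := by
  rw [cellFourierCoeff_eq_integral hL, Complex.real_smul, norm_mul, Complex.norm_real,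
    Real.norm_of_nonneg (inv_nonneg.2 (pow_nonneg hL.le 3))]
  refine mul_le_of_le_one_right (inv_nonneg.2 (pow_nonneg hL.le 3)) ?_
  calc ‖∫ y in cell L, conj (cellWave L P y) * (fibrePsi Φ (Function.update X 0 y) : ℂ) ^ 2‖
      ≤ ∫ y in cell L, ‖conj (cellWave L P y) * (fibrePsi Φ (Function.update X 0 y) : ℂ) ^ 2‖ :=
        norm_integral_le_integral_norm _
    _ = ∫ y in cell L, fibrePsi Φ (Function.update X 0 y) ^ 2 := by
        refine setIntegral_congr_fun (measurableSet_cell L) fun y _ => ?_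
        rw [norm_mul, RCLike.norm_conj, norm_cellWave, one_mul, norm_pow, Complex.norm_real,
          Real.norm_of_nonneg (fibrePsi_nonneg Φ _)]
    _ = 1 := integral_fibrePsi_sq hL Φ hΦ X

/-- **Index shift and decomposition**: `ĉ_{P−n}(ψ) = ĉ_P(e_nψ − βψ²) + β ĉ_P(ψ²)` on every fibre.
[folklore] -/
theorem cellFourierCoeff_fibrePsi_shift (hL : 0 < L) (n : Fin 3 → ℤ) (Φ : PeriodicTrialState (m + 1) L)
    (hΦ : ∀ X, Φ.ψ X ≠ 0) (X : Config (m + 1)) (P : Fin 3 → ℤ) :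
    cellFourierCoeff L (fun y => (fibrePsi Φ (Function.update X 0 y) : ℂ)) (P - n) =
      cellFourierCoeff L (fun y => phase L n y * (fibrePsi Φ (Function.update X 0 y) : ℂ) -
          fibreBeta n Φ X * (fibrePsi Φ (Function.update X 0 y) : ℂ) ^ 2) P +
        fibreBeta n Φ X *
          cellFourierCoeff L (fun y => (fibrePsi Φ (Function.update X 0 y) : ℂ) ^ 2) P := by
  have hψc : Continuous fun y : Space => (fibrePsi Φ (Function.update X 0 y) : ℂ) :=
    Complex.continuous_ofReal.comp
      ((continuous_fibrePsi hL Φ hΦ).comp (continuous_const.update 0 continuous_id))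
  have h1 : Continuous fun y : Space => phase L n y * (fibrePsi Φ (Function.update X 0 y) : ℂ) -
      fibreBeta n Φ X * (fibrePsi Φ (Function.update X 0 y) : ℂ) ^ 2 := by
    exact ((contDiff_phase L n (k := 1)).continuous.mul hψc).sub (continuous_const.mul (hψc.pow 2))
  have h2 : Continuous fun y : Space =>
      fibreBeta n Φ X * (fibrePsi Φ (Function.update X 0 y) : ℂ) ^ 2 :=
    continuous_const.mul (hψc.pow 2)
  rw [← cellFourierCoeff_const_mul hL, ← ps_cellFourierCoeff_add hL h1 h2,
    ← ps_cellFourierCoeff_cellWave_mul hL n P]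
  congr 1
  funext y
  rw [phase_eq_cellWave]
  ring

/-- **Fibrewise comparison**: `W|ĉ_{P−n}(ψ)|² ≤ 2W|ĉ_P(e_nψ − βψ²)|² + 2W|ĉ_{−n}(ψ)|²`, using
`|β ĉ_P(ψ²)| ≤ |β|/L³ = |ĉ_{−n}(ψ)|`. [folklore] -/
theorem fibreW_mul_norm_sq_shift_le (hL : 0 < L) (n : Fin 3 → ℤ) (Φ : PeriodicTrialState (m + 1) L)
    (hΦ : ∀ X, Φ.ψ X ≠ 0) (X : Config (m + 1)) (P : Fin 3 → ℤ) :
    fibreW Φ X * ‖cellFourierCoeff L (fun y => (fibrePsi Φ (Function.update X 0 y) : ℂ)) (P - n)‖ ^ 2 ≤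
      2 * (fibreW Φ X * ‖cellFourierCoeff L (fun y =>
          phase L n y * (fibrePsi Φ (Function.update X 0 y) : ℂ) -
            fibreBeta n Φ X * (fibrePsi Φ (Function.update X 0 y) : ℂ) ^ 2) P‖ ^ 2) +
        2 * (fibreW Φ X *
          ‖cellFourierCoeff L (fun y => (fibrePsi Φ (Function.update X 0 y) : ℂ)) (-n)‖ ^ 2) := by
  set A := cellFourierCoeff L (fun y => phase L n y * (fibrePsi Φ (Function.update X 0 y) : ℂ) -
    fibreBeta n Φ X * (fibrePsi Φ (Function.update X 0 y) : ℂ) ^ 2) P with hA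
  set c := cellFourierCoeff L (fun y => (fibrePsi Φ (Function.update X 0 y) : ℂ)) (-n) with hc
  set d := cellFourierCoeff L (fun y => (fibrePsi Φ (Function.update X 0 y) : ℂ) ^ 2) P with hd
  have hW := fibreW_nonneg Φ X
  have hshift := cellFourierCoeff_fibrePsi_shift hL n Φ hΦ X P
  have hβ : fibreBeta n Φ X = ((L ^ 3 : ℝ) : ℂ) * c := fibreBeta_eq_cellFourierCoeff hL n Φ X
  have hy : ‖fibreBeta n Φ X * d‖ ≤ ‖c‖ := by
    rw [norm_mul, hβ, norm_mul, Complex.norm_real, Real.norm_of_nonneg (pow_nonneg hL.le 3)]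
    calc L ^ 3 * ‖c‖ * ‖d‖ ≤ L ^ 3 * ‖c‖ * (L ^ 3)⁻¹ := by
          gcongr
          exact norm_cellFourierCoeff_fibrePsi_sq_le hL Φ hΦ X P
      _ = ‖c‖ := by field_simp
  rw [hshift, ← hA, ← hd]
  have h2 : ‖A + fibreBeta n Φ X * d‖ ^ 2 ≤ 2 * ‖A‖ ^ 2 + 2 * ‖fibreBeta n Φ X * d‖ ^ 2 := by
    have h := norm_add_le A (fibreBeta n Φ X * d)
    nlinarith [sq_nonneg (‖A‖ - ‖fibreBeta n Φ X * d‖), norm_nonneg (A + fibreBeta n Φ X * d),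
      norm_nonneg A, norm_nonneg (fibreBeta n Φ X * d)]
  have h3 : ‖fibreBeta n Φ X * d‖ ^ 2 ≤ ‖c‖ ^ 2 := pow_le_pow_left₀ (norm_nonneg _) hy 2
  calc fibreW Φ X * ‖A + fibreBeta n Φ X * d‖ ^ 2
      ≤ fibreW Φ X * (2 * ‖A‖ ^ 2 + 2 * ‖c‖ ^ 2) :=
        mul_le_mul_of_nonneg_left (h2.trans (by linarith)) hW
    _ = 2 * (fibreW Φ X * ‖A‖ ^ 2) + 2 * (fibreW Φ X * ‖c‖ ^ 2) := by ring

/-- **OCCUPATION CONTINUITY — the crux's infrared content in occupation numbers.** `FibreConductance`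
forces, with its own constants `ρ₀, C, N₀` and on every exact zero-free datum of its window, for every
lattice vector `P`: `n_{P−n}(|Φ|) ≤ 2 n_{−n}(|Φ|) + 8π² C |P|₂² N/‖n‖²` (`n_q = cellOccupation` of
`planeWaveMode L q` in `|Φ|`). At `|P| = 1` and the top of the window this is single-mode occupation
control at `O(L) = O(N^{1/3})` particles per mode in the thermodynamic limit. [folklore] -/
theorem occupationContinuity_of_fibreConductance : FibreConductance →
    LowDensityWindow fun m L n Φ C => ∀ P : Fin 3 → ℤ,
      cellOccupation (m + 1) L (planeWaveMode L (P - n)) (fun X => (‖Φ.ψ X‖ : ℂ)) ≤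
        2 * cellOccupation (m + 1) L (planeWaveMode L (-n)) (fun X => (‖Φ.ψ X‖ : ℂ)) +
          ENNReal.ofReal (8 * Real.pi ^ 2 * C * nsq P / ‖(fun j => (n j : ℝ))‖ ^ 2) *
            (m + 1 : ℝ≥0∞) := by
  intro h v hv hbdd M hM
  obtain ⟨ρ₀, C, hρ₀, hC, N₀, hmain⟩ := infraredNecessity h v hv hbdd M hM
  refine ⟨ρ₀, C, hρ₀, hC, N₀, fun m hm L hL hρ n hn hw Φ hE hz P => ?_⟩
  have hIR := hmain m hm L hL hρ n hn hw Φ hE hz P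
  -- the three bath integrals
  set F : Config (m + 1) → ℝ≥0∞ := fun X => ENNReal.ofReal (fibreW Φ X *
    ‖cellFourierCoeff L (fun y => phase L n y * (fibrePsi Φ (Function.update X 0 y) : ℂ) -
      fibreBeta n Φ X * (fibrePsi Φ (Function.update X 0 y) : ℂ) ^ 2) P‖ ^ 2) with hF
  set G : Config (m + 1) → ℝ≥0∞ := fun X => ENNReal.ofReal (fibreW Φ X *
    ‖cellFourierCoeff L (fun y => (fibrePsi Φ (Function.update X 0 y) : ℂ)) (-n)‖ ^ 2) with hG
  have hGm : Measurable G :=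
    ((measurable_fibreW Φ).mul
      ((continuous_cellFourierCoeff_fibrePsi hL Φ hz (-n)).measurable.norm.pow_const 2)).ennreal_ofReal
  have hocc : ∀ q : Fin 3 → ℤ, ∫⁻ X in cellN (m + 1) L, ENNReal.ofReal (fibreW Φ X *
      ‖cellFourierCoeff L (fun y => (fibrePsi Φ (Function.update X 0 y) : ℂ)) q‖ ^ 2) =
        cellOccupation (m + 1) L (planeWaveMode L q) (fun X => (‖Φ.ψ X‖ : ℂ)) / (m + 1 : ℝ≥0∞) :=
    fun q => lintegral_fibreW_mul_norm_sq_cellFourierCoeff hL Φ hz q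
  -- pointwise comparison, integrated
  have hpt : ∀ X, ENNReal.ofReal (fibreW Φ X *
      ‖cellFourierCoeff L (fun y => (fibrePsi Φ (Function.update X 0 y) : ℂ)) (P - n)‖ ^ 2) ≤
        2 * F X + 2 * G X := by
    intro X
    have h := fibreW_mul_norm_sq_shift_le hL n Φ hz X P
    have hF0 : 0 ≤ fibreW Φ X * ‖cellFourierCoeff L (fun y =>
        phase L n y * (fibrePsi Φ (Function.update X 0 y) : ℂ) -
          fibreBeta n Φ X * (fibrePsi Φ (Function.update X 0 y) : ℂ) ^ 2) P‖ ^ 2 :=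
      mul_nonneg (fibreW_nonneg Φ X) (sq_nonneg _)
    have hG0 : 0 ≤ fibreW Φ X *
        ‖cellFourierCoeff L (fun y => (fibrePsi Φ (Function.update X 0 y) : ℂ)) (-n)‖ ^ 2 :=
      mul_nonneg (fibreW_nonneg Φ X) (sq_nonneg _)
    calc _ ≤ ENNReal.ofReal (2 * (fibreW Φ X * ‖cellFourierCoeff L (fun y =>
          phase L n y * (fibrePsi Φ (Function.update X 0 y) : ℂ) -
            fibreBeta n Φ X * (fibrePsi Φ (Function.update X 0 y) : ℂ) ^ 2) P‖ ^ 2) +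
          2 * (fibreW Φ X *
            ‖cellFourierCoeff L (fun y => (fibrePsi Φ (Function.update X 0 y) : ℂ)) (-n)‖ ^ 2)) :=
          ENNReal.ofReal_le_ofReal h
      _ = 2 * F X + 2 * G X := by
          rw [ENNReal.ofReal_add (by positivity) (by positivity), ENNReal.ofReal_mul zero_le_two,
            ENNReal.ofReal_mul zero_le_two, ENNReal.ofReal_ofNat]
  have hint : ∫⁻ X in cellN (m + 1) L, ENNReal.ofReal (fibreW Φ X *
      ‖cellFourierCoeff L (fun y => (fibrePsi Φ (Function.update X 0 y) : ℂ)) (P - n)‖ ^ 2) ≤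
        2 * ENNReal.ofReal (4 * Real.pi ^ 2 * C * nsq P / ‖(fun j => (n j : ℝ))‖ ^ 2) +
          2 * (cellOccupation (m + 1) L (planeWaveMode L (-n)) (fun X => (‖Φ.ψ X‖ : ℂ)) /
            (m + 1 : ℝ≥0∞)) := by
    calc _ ≤ ∫⁻ X in cellN (m + 1) L, (2 * F X + 2 * G X) := lintegral_mono hpt
      _ = (∫⁻ X in cellN (m + 1) L, 2 * F X) + ∫⁻ X in cellN (m + 1) L, 2 * G X :=
          lintegral_add_right _ (hGm.const_mul 2)
      _ = 2 * (∫⁻ X in cellN (m + 1) L, F X) + 2 * ∫⁻ X in cellN (m + 1) L, G X := by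
          rw [lintegral_const_mul' _ _ ENNReal.ofNat_ne_top,
            lintegral_const_mul' _ _ ENNReal.ofNat_ne_top]
      _ ≤ _ := add_le_add (mul_le_mul_right hIR 2) (mul_le_mul_right (hocc (-n)).le 2)
  -- multiply through by `N = m + 1`
  have hN0 : (m + 1 : ℝ≥0∞) ≠ 0 := by positivity
  have hNtop : (m + 1 : ℝ≥0∞) ≠ ⊤ := by simp
  rw [hocc (P - n)] at hint
  have h8 : 2 * ENNReal.ofReal (4 * Real.pi ^ 2 * C * nsq P / ‖(fun j => (n j : ℝ))‖ ^ 2) =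
      ENNReal.ofReal (8 * Real.pi ^ 2 * C * nsq P / ‖(fun j => (n j : ℝ))‖ ^ 2) := by
    rw [← ENNReal.ofReal_ofNat 2, ← ENNReal.ofReal_mul zero_le_two]
    congr 1
    ring
  calc cellOccupation (m + 1) L (planeWaveMode L (P - n)) (fun X => (‖Φ.ψ X‖ : ℂ))
      = cellOccupation (m + 1) L (planeWaveMode L (P - n)) (fun X => (‖Φ.ψ X‖ : ℂ)) /
          (m + 1 : ℝ≥0∞) * (m + 1 : ℝ≥0∞) := (ENNReal.div_mul_cancel hN0 hNtop).symm
    _ ≤ (2 * ENNReal.ofReal (4 * Real.pi ^ 2 * C * nsq P / ‖(fun j => (n j : ℝ))‖ ^ 2) +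
          2 * (cellOccupation (m + 1) L (planeWaveMode L (-n)) (fun X => (‖Φ.ψ X‖ : ℂ)) /
            (m + 1 : ℝ≥0∞))) * (m + 1 : ℝ≥0∞) := by gcongr
    _ = 2 * cellOccupation (m + 1) L (planeWaveMode L (-n)) (fun X => (‖Φ.ψ X‖ : ℂ)) +
          ENNReal.ofReal (8 * Real.pi ^ 2 * C * nsq P / ‖(fun j => (n j : ℝ))‖ ^ 2) *
            (m + 1 : ℝ≥0∞) := by
        rw [add_mul, mul_assoc 2 (_ / _), ENNReal.div_mul_cancel hN0 hNtop, h8, add_comm]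

end Summit.AtomisticToContinuum.BoseEinsteinCondensation.Cruxes.FibreConductance.CondensateFloor

end
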